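import Summits.QuantumAdvantage.AdviceFreeQNC0.PLDAMSFence
import Summits.QuantumAdvantage.AdviceFreeQNC0.WindowDegree
import Summits.QuantumAdvantage.AdviceFreeQNC0.CleanGapStrategies
import Literature.Computability.Complexity.VaziraniXorLemma
import HarnessLib

/-!
# Cell qa-qnc0 (rung F-Q1, route RingFrame, crux α `RingToElim`): THE √(n·log(1/κ)) FENCE OF THE
# ATOM METHOD WITH AN ABSOLUTE CONSTANT — `PLDAMSBool κ₀ D'` fails at degree `8·√(n(1 + log(1/κ₀)))`

Every landed product/window argument of the cell (level sets, THEOREM U/V, R1–R3, T8, T9) ends in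
PLDAMS — `PLDAMSBool κ₀ D'`: every Boolean `f` of degree `≤ D' n` has at least a `κ₀`-fraction of
its support in every class mod `3` (`LDMATransfer.lean`; a theorem at `D' n = ⌊c√n⌋`,
`pldamsBool_sqrt`).  The planner's FENCE (ROUND-10 §4, Sketch11 §23.5b) `NotPLDAMSAboveSqrtLog` —
for every `κ₀` SOME `C(κ₀)` — is the theorem `not_pldams_above_sqrt_log` of `PLDAMSFence.lean`
(literature seat qn-lit, Chebyshev tail, `C = 16/√κ₀`).  This file proves the `log`-SHARP form with
ONE ABSOLUTE CONSTANT, as in the planner's prose (`d ≥ √(2L·ln(4/κ))`):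
**`∃ C (= 8), ∀ κ₀ > 0`: `PLDAMSBool κ₀ D'` is FALSE as soon as `D' n ≥ C·√(n·(1 + log(1/κ₀)))`
eventually** (`not_pldams_above_sqrt_log_absolute`; Hoeffding tails instead of Chebyshev), and
re-derives the typed statement from it (`notPLDAMSAboveSqrtLog_of_absolute`).

Witness (`not_pldams_above_sqrt_log`, `C = 8`): with `d = 2^ℓ ≤ D' n + 1 < 2d` and the window
`W = [w₀, w₀ + d)`, `w₀ = ⌊(n − d)/2⌋`, let `f(u) := [wt u mod d ∈ {w mod d : w ∈ W, w ≡ 0 (3)}]`.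
* `f` is a function of `wt u mod 2^ℓ`, hence (Lucas; the tree's `Hegedus.lucasPoly`) of `𝔽₂`-degree
  `≤ 2^ℓ − 1 ≤ D' n` (`hasDeg_wtModSet`);
* on the window `wt u ∈ W`, `f u ⇔ wt u ≡ 0 (mod 3)` (residues mod `d` separate `W`), so
  `supp f ∩ {wt ≡ 1} ⊆ {wt ∉ W}` and `supp f ⊇ {wt ∈ W, wt ≡ 0}`;
* `#{wt ∉ W} ≤ 2·e^{−(d−1)²/(2n)}·2ⁿ` (Hoeffding, `card_biased_strings_le`) `≤ 2e^{−8}κ₀^8·2ⁿ`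
  since `d − 1 ≥ D' n / 2 ≥ 4√(n(1 + log(1/κ₀)))`, while `#{wt ≡ 0} ≥ (2ⁿ − 2)/3`;
  `κ₀·#supp f ≤ #(supp f ∩ {wt ≡ 1})` is then absurd.
(`κ₀ > 1/2` is refuted by the constant function, `D' n ≥ n` by the exact class indicator.)

The cell's certificate (planner qa-qnc0-p1 gen 11 ask P14, absolute-constant form; prover
qa-qnc0-prover gen 6, 2026-08-27); the construction is the folklore upper-bound half of Hegedűs's
lemma (symmetric periodic approximation of `MOD₃`).  WHAT THIS IS NOT: says nothing about non-atom
handles, `LDMAPolylog`, or α; an instrument bounding a METHOD, not a statement about the walk game.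
-/

noncomputable section

namespace Summit.QuantumAdvantage.AdviceFreeQNC0

open Finset
open Literature.Computability.MetaComplexity Literature.Computability.MetaComplexity.Smolensky

namespace PLDAMSFenceAbs

variable {n : ℕ}

/-! ### The three classes partition the cube -/

/-- `#{wt ≡ 0} + #{wt ≡ 1} + #{wt ≡ 2} = 2ⁿ`. [folklore] -/
theorem card_classes_sum (n : ℕ) :
    (univ.filter fun u : Fin n → Bool => wt u % 3 = 0).card +
      (univ.filter fun u : Fin n → Bool => wt u % 3 = 1).card +
      (univ.filter fun u : Fin n → Bool => wt u % 3 = 2).card = 2 ^ n := by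
  have h : ∀ u ∈ (univ : Finset (Fin n → Bool)), (1 : ℕ) =
      (if wt u % 3 = 0 then 1 else 0) + (if wt u % 3 = 1 then 1 else 0) +
        (if wt u % 3 = 2 then 1 else 0) := by
    intro u _
    have : wt u % 3 < 3 := Nat.mod_lt _ (by norm_num)
    split_ifs <;> omega
  have htot : (univ : Finset (Fin n → Bool)).card = 2 ^ n := by
    rw [Finset.card_univ, Fintype.card_fun, Fintype.card_bool, Fintype.card_fin]
  have e : ∀ r : ℕ, (univ.filter fun u : Fin n → Bool => wt u % 3 = r).card =
      ∑ u : Fin n → Bool, (if wt u % 3 = r then 1 else 0) := fun r => Finset.card_filter _ _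
  rw [e, e, e, ← Finset.sum_add_distrib, ← Finset.sum_add_distrib, ← htot, Finset.card_eq_sum_ones]
  exact (Finset.sum_congr rfl h).symm

/-- `PLDAMSBool κ₀ D'` forces `κ₀ ≤ 1/3` (the constant function `1` has degree `0`). -/
theorem le_third_of_pldamsBool {κ₀ : ℝ} {D' : ℕ → ℕ} (h : PLDAMSBool κ₀ D') : κ₀ ≤ 1 / 3 := by
  obtain ⟨n₀, hn₀⟩ := h
  have H := hn₀ n₀ le_rfl (fun _ => true) (hasDeg_const true _)
  have e : (univ.filter fun u : Fin n₀ → Bool => true = true) = univ := Finset.filter_true_of_mem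
    (fun _ _ => rfl)
  have er : ∀ r : ℕ, (univ.filter fun u : Fin n₀ → Bool => true = true ∧ wt u % 3 = r % 3) =
      univ.filter fun u : Fin n₀ → Bool => wt u % 3 = r % 3 := fun r =>
    Finset.filter_congr fun u _ => by simp
  have h0 := H 0; have h1 := H 1; have h2 := H 2
  rw [e, er] at h0 h1 h2
  rw [Finset.card_univ, Fintype.card_fun, Fintype.card_bool, Fintype.card_fin] at h0 h1 h2
  have hsum := card_classes_sum n₀
  simp only [Nat.zero_mod, Nat.one_mod, show (2 : ℕ) % 3 = 2 from rfl] at h0 h1 h2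
  have hsumR : ((univ.filter fun u : Fin n₀ → Bool => wt u % 3 = 0).card : ℝ) +
      ((univ.filter fun u : Fin n₀ → Bool => wt u % 3 = 1).card : ℝ) +
      ((univ.filter fun u : Fin n₀ → Bool => wt u % 3 = 2).card : ℝ) = ((2 ^ n₀ : ℕ) : ℝ) := by
    exact_mod_cast hsum
  have hpos : (0 : ℝ) < ((2 ^ n₀ : ℕ) : ℝ) := by positivity
  push_cast at h0 h1 h2 hsumR hpos
  nlinarith

/-! ### Symmetric periodic functions have low degree (Lucas) -/

/-- **A function of `wt u mod 2^ℓ` has `𝔽₂`-degree `≤ 2^ℓ − 1`** (Lucas; the tree's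
`Hegedus.lucasPoly`): for every set `S` of residues, `u ↦ [wt u mod 2^ℓ ∈ S]` has
`HasDeg · (2^ℓ − 1)`. [folklore] -/
theorem hasDeg_wtModSet (ℓ : ℕ) (S : Finset ℕ) (hS : ∀ r ∈ S, r < 2 ^ ℓ) :
    HasDeg (fun u : Fin n → Bool => decide (wt u % 2 ^ ℓ ∈ S)) (2 ^ ℓ - 1) := by
  unfold HasDeg
  have heq : (fun u : Fin n → Bool => if decide (wt u % 2 ^ ℓ ∈ S) = true then (1 : ZMod 2) else 0) =
      ∑ r ∈ S, Hegedus.lucasPoly (ZMod 2) n 2 ℓ r := by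
    funext u
    rw [Finset.sum_apply]
    have hwt : Hegedus.wt u = wt u := rfl
    simp only [Hegedus.lucasPoly_apply 2, hwt]
    have hr : ∀ r ∈ S, (if wt u % 2 ^ ℓ = r % 2 ^ ℓ then (1 : ZMod 2) else 0) =
        if wt u % 2 ^ ℓ = r then 1 else 0 := fun r hr => by rw [Nat.mod_eq_of_lt (hS r hr)]
    rw [Finset.sum_congr rfl hr, Finset.sum_ite_eq]
    by_cases h : wt u % 2 ^ ℓ ∈ S <;> simp [h]
  rw [heq]
  exact Submodule.sum_mem _ fun r _ => Hegedus.lucasPoly_mem_lowDeg 2 ℓ r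

/-! ### Hoeffding tails for the Hamming weight -/

/-- Upper tail: `#{u : (1/2 + γ)n ≤ wt u} ≤ e^{−2γ²n}·2ⁿ`. [folklore] -/
theorem card_wt_ge_le {γ : ℝ} (hγ : 0 ≤ γ) :
    ((univ.filter fun u : Fin n → Bool => (1 / 2 + γ) * n ≤ (wt u : ℝ)).card : ℝ) ≤
      Real.exp (-(2 * γ ^ 2 * n)) * 2 ^ n :=
  Literature.Computability.Complexity.XorLemma.card_biased_strings_le n hγ true

/-- Lower tail: `#{u : (1/2 + γ)n ≤ n − wt u} ≤ e^{−2γ²n}·2ⁿ`. [folklore] -/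
theorem card_wt_le_le {γ : ℝ} (hγ : 0 ≤ γ) :
    ((univ.filter fun u : Fin n → Bool => (1 / 2 + γ) * n ≤ ((n - wt u : ℕ) : ℝ)).card : ℝ) ≤
      Real.exp (-(2 * γ ^ 2 * n)) * 2 ^ n := by
  have h := Literature.Computability.Complexity.XorLemma.card_biased_strings_le n hγ false
  refine le_trans (le_of_eq ?_) h
  congr 2
  refine Finset.filter_congr fun u _ => ?_
  have hc : (univ.filter fun i : Fin n => u i = false).card = n - wt u := by
    have := Finset.card_filter_add_card_filter_not (s := (univ : Finset (Fin n))) (fun i => u i = true)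
    rw [Finset.card_univ, Fintype.card_fin] at this
    have e : (univ.filter fun i : Fin n => ¬ u i = true) = univ.filter fun i : Fin n => u i = false :=
      Finset.filter_congr fun i _ => by simp
    rw [e] at this
    unfold wt
    omega
  rw [hc]

/-! ### The certificate -/

/-- Residues mod `d` separate a window of length `d`. [folklore] -/
private theorem eq_of_mod_eq_of_window {d w₀ a b : ℕ} (ha : w₀ ≤ a) (ha' : a < w₀ + d) (hb : w₀ ≤ b)
    (hb' : b < w₀ + d) (h : a % d = b % d) : a = b := by
  rcases le_total a b with hab | hab
  · have hdvd : d ∣ b - a := (Nat.modEq_iff_dvd' hab).1 h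
    have hlt : b - a < d := by omega
    have := Nat.eq_zero_of_dvd_of_lt hdvd hlt
    omega
  · have hdvd : d ∣ a - b := (Nat.modEq_iff_dvd' hab).1 h.symm
    have hlt : a - b < d := by omega
    have := Nat.eq_zero_of_dvd_of_lt hdvd hlt
    omega

/-- `e^{-8(1+L)} ≤ κ₀⁸ / e⁸` for `L = log(1/κ₀)`. -/
private theorem exp_neg_eight_mul_le {κ₀ : ℝ} (hκ₀ : 0 < κ₀) :
    Real.exp (-(8 * (1 + Real.log (1 / κ₀)))) = Real.exp (-8) * κ₀ ^ 8 := by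
  have h8 : Real.exp (8 * Real.log κ₀) = κ₀ ^ 8 := by
    rw [show (8 : ℝ) * Real.log κ₀ = ((8 : ℕ) : ℝ) * Real.log κ₀ by norm_num, Real.exp_nat_mul,
      Real.exp_log hκ₀]
  rw [show -(8 * (1 + Real.log (1 / κ₀))) = -8 + 8 * Real.log κ₀ by
    rw [one_div, Real.log_inv]; ring, Real.exp_add, h8]

end PLDAMSFenceAbs

open PLDAMSFenceAbs in
/-- **THE FENCE WITH AN ABSOLUTE CONSTANT, PROVED** (`C = 8`, uniformly in `κ₀`): for every `κ₀ > 0`,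
`PLDAMSBool κ₀ D'` fails as soon as `D' n ≥ 8·√(n·(1 + log(1/κ₀)))` for all large `n`. [folklore] -/
theorem not_pldams_above_sqrt_log_absolute :
    ∃ C : ℝ, 0 < C ∧ ∀ κ₀ : ℝ, 0 < κ₀ → ∀ D' : ℕ → ℕ,
      (∃ n₁ : ℕ, ∀ n ≥ n₁, C * Real.sqrt (n * (1 + Real.log (1 / κ₀))) ≤ (D' n : ℝ)) →
      ¬ PLDAMSBool κ₀ D' := by
  refine ⟨8, by norm_num, fun κ₀ hκ₀ D' ⟨n₁, hn₁⟩ hP => ?_⟩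
  have hκ3 : κ₀ ≤ 1 / 3 := le_third_of_pldamsBool hP
  obtain ⟨n₀, hn₀⟩ := hP
  -- a large `n`
  set n := max n₀ (max n₁ 2) with hn
  have hn₀n : n₀ ≤ n := le_max_left _ _
  have hn₁n : n₁ ≤ n := le_trans (le_max_left _ _) (le_max_right _ _)
  have hn2 : 2 ≤ n := le_trans (le_max_right _ _) (le_max_right _ _)
  have hclass0 := three_mul_card_class_add_two_ge n 0
  simp only [Nat.zero_mod] at hclass0
  -- case `D' n ≥ n`: the exact class indicator has degree `≤ n`
  by_cases hDn : n ≤ D' n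
  · have H := hn₀ n hn₀n (fun u => decide (wt u % 3 = 0))
      (hasDeg_of_le (hasDeg_self _) hDn) 1
    have e1 : (univ.filter fun u : Fin n → Bool => decide (wt u % 3 = 0) = true ∧ wt u % 3 = 1 % 3) = ∅ := by
      rw [Finset.filter_eq_empty_iff]
      intro u _ h
      simp only [decide_eq_true_eq, Nat.one_mod] at h
      omega
    have e0 : (univ.filter fun u : Fin n → Bool => decide (wt u % 3 = 0) = true) =
        univ.filter fun u : Fin n → Bool => wt u % 3 = 0 := Finset.filter_congr fun u _ => by simp
    rw [e1, e0, Finset.card_empty] at H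
    have hpos : (0 : ℝ) < ((univ.filter fun u : Fin n → Bool => wt u % 3 = 0).card : ℝ) := by
      have : 1 ≤ (univ.filter fun u : Fin n → Bool => wt u % 3 = 0).card := by
        have h4 : 4 ≤ 2 ^ n := by
          calc 4 = 2 ^ 2 := by norm_num
            _ ≤ 2 ^ n := Nat.pow_le_pow_right (by norm_num) hn2
        have h5 := hclass0
        generalize 2 ^ n = N at h4 h5
        omega
      exact_mod_cast this
    push_cast at H
    nlinarith
  -- main case `D' n < n`
  push Not at hDn
  set ℓ := Nat.log 2 (D' n + 1) with hℓ
  set d := 2 ^ ℓ with hd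
  have hd1 : d ≤ D' n + 1 := Nat.pow_log_le_self 2 (by omega)
  have hd2 : D' n + 1 < 2 * d := by
    have h := Nat.lt_pow_succ_log_self (b := 2) one_lt_two (D' n + 1)
    rw [← hℓ, pow_succ, ← hd] at h
    omega
  have hdn : d ≤ n := by omega
  have hdpos : 1 ≤ d := Nat.one_le_two_pow
  set w₀ := (n - d) / 2 with hw₀
  have hw₀1 : 2 * w₀ + d ≤ n := by omega
  have hw₀2 : n ≤ 2 * w₀ + d + 1 := by omega
  -- the window and the witness
  set W : Finset ℕ := Finset.Ico w₀ (w₀ + d) with hW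
  set S : Finset ℕ := (W.filter fun w => w % 3 = 0).image fun w => w % d with hS
  have hSlt : ∀ r ∈ S, r < 2 ^ ℓ := by
    intro r hr
    rw [hS, Finset.mem_image] at hr
    obtain ⟨w, _, rfl⟩ := hr
    exact Nat.mod_lt _ (by positivity)
  set f : (Fin n → Bool) → Bool := fun u => decide (wt u % 2 ^ ℓ ∈ S) with hf
  have hfdeg : HasDeg f (D' n) :=
    hasDeg_of_le (hasDeg_wtModSet ℓ S hSlt) (by omega)
  -- on the window, `f = [wt ≡ 0 (3)]`
  have hf_window : ∀ u : Fin n → Bool, w₀ ≤ wt u → wt u < w₀ + d →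
      (f u = true ↔ wt u % 3 = 0) := by
    intro u h1 h2
    simp only [hf, decide_eq_true_eq, hS, Finset.mem_image, Finset.mem_filter, hW, Finset.mem_Ico]
    constructor
    · rintro ⟨w, ⟨⟨hw1, hw2⟩, hw3⟩, hw4⟩
      have := eq_of_mod_eq_of_window hw1 hw2 h1 h2 hw4
      rw [← this]
      exact hw3
    · intro h
      exact ⟨wt u, ⟨⟨h1, h2⟩, h⟩, rfl⟩
  -- PLDAMS applied to `f` at class `1`
  have H := hn₀ n hn₀n f hfdeg 1
  -- the tails
  set γ : ℝ := ((d - 1 : ℕ) : ℝ) / (2 * n) with hγ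
  have hnpos : (0 : ℝ) < n := by exact_mod_cast (by omega : 0 < n)
  have hγ0 : 0 ≤ γ := by rw [hγ]; positivity
  set ε : ℝ := Real.exp (-(2 * γ ^ 2 * n)) with hε
  have htail_hi := card_wt_ge_le (n := n) hγ0
  have htail_lo := card_wt_le_le (n := n) hγ0
  rw [← hε] at htail_hi htail_lo
  have hγn : (1 / 2 + γ) * n = (n : ℝ) / 2 + ((d - 1 : ℕ) : ℝ) / 2 := by
    rw [hγ]
    calc (1 / 2 + ((d - 1 : ℕ) : ℝ) / (2 * n)) * n = (n : ℝ) / 2 + ((d - 1 : ℕ) : ℝ) / 2 * (n / n) := by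
          ring
      _ = (n : ℝ) / 2 + ((d - 1 : ℕ) : ℝ) / 2 := by rw [div_self (ne_of_gt hnpos), mul_one]
  -- `{wt ∉ W} ⊆ hi-tail ∪ lo-tail`
  have houtside : ((univ.filter fun u : Fin n → Bool => ¬ (w₀ ≤ wt u ∧ wt u < w₀ + d)).card : ℝ) ≤
      2 * ε * 2 ^ n := by
    have hsub : (univ.filter fun u : Fin n → Bool => ¬ (w₀ ≤ wt u ∧ wt u < w₀ + d)) ⊆
        (univ.filter fun u : Fin n → Bool => (1 / 2 + γ) * n ≤ (wt u : ℝ)) ∪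
        (univ.filter fun u : Fin n → Bool => (1 / 2 + γ) * n ≤ ((n - wt u : ℕ) : ℝ)) := by
      intro u hu
      rw [Finset.mem_filter] at hu
      rw [Finset.mem_union, Finset.mem_filter, Finset.mem_filter, hγn]
      have hwtn : wt u ≤ n := by
        unfold wt
        exact le_trans (Finset.card_le_univ _) (by rw [Fintype.card_fin])
      by_cases hlo : wt u < w₀
      · right
        refine ⟨Finset.mem_univ _, ?_⟩
        have h1 : ((d - 1 : ℕ) : ℝ) = (d : ℝ) - 1 := by
          rw [Nat.cast_sub hdpos]; simp
        have h2 : ((n - wt u : ℕ) : ℝ) = (n : ℝ) - wt u := by rw [Nat.cast_sub hwtn]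
        rw [h1, h2]
        have h3 : ((wt u : ℕ) : ℝ) + 1 ≤ w₀ := by exact_mod_cast hlo
        have h4 : (2 * w₀ + d : ℝ) ≤ n := by exact_mod_cast hw₀1
        linarith
      · left
        refine ⟨Finset.mem_univ _, ?_⟩
        have hhi : w₀ + d ≤ wt u := by
          by_contra h
          exact hu.2 ⟨by omega, by omega⟩
        have h1 : ((d - 1 : ℕ) : ℝ) = (d : ℝ) - 1 := by
          rw [Nat.cast_sub hdpos]; simp
        rw [h1]
        have h3 : ((w₀ : ℕ) : ℝ) + d ≤ wt u := by exact_mod_cast hhi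
        have h4 : (n : ℝ) ≤ 2 * w₀ + d + 1 := by exact_mod_cast hw₀2
        linarith
    calc ((univ.filter fun u : Fin n → Bool => ¬ (w₀ ≤ wt u ∧ wt u < w₀ + d)).card : ℝ)
        ≤ (((univ.filter fun u : Fin n → Bool => (1 / 2 + γ) * n ≤ (wt u : ℝ)) ∪
            (univ.filter fun u : Fin n → Bool => (1 / 2 + γ) * n ≤ ((n - wt u : ℕ) : ℝ))).card : ℝ) := by
          exact_mod_cast Finset.card_le_card hsub
      _ ≤ ((univ.filter fun u : Fin n → Bool => (1 / 2 + γ) * n ≤ (wt u : ℝ)).card : ℝ) +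
            ((univ.filter fun u : Fin n → Bool => (1 / 2 + γ) * n ≤ ((n - wt u : ℕ) : ℝ)).card : ℝ) := by
          exact_mod_cast Finset.card_union_le _ _
      _ ≤ ε * 2 ^ n + ε * 2 ^ n := add_le_add htail_hi htail_lo
      _ = 2 * ε * 2 ^ n := by ring
  -- bad points: `supp f ∩ {wt ≡ 1} ⊆ {wt ∉ W}`
  have hbad : ((univ.filter fun u : Fin n → Bool => f u = true ∧ wt u % 3 = 1 % 3).card : ℝ) ≤
      2 * ε * 2 ^ n := by
    refine le_trans ?_ houtside
    exact_mod_cast Finset.card_le_card fun u hu => by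
      rw [Finset.mem_filter] at hu ⊢
      refine ⟨hu.1, fun hw => ?_⟩
      have := (hf_window u hw.1 hw.2).1 hu.2.1
      have := hu.2.2
      omega
  -- good points: `supp f ⊇ {wt ≡ 0} \ {wt ∉ W}`
  have hgood : ((univ.filter fun u : Fin n → Bool => wt u % 3 = 0).card : ℝ) ≤
      ((univ.filter fun u : Fin n → Bool => f u = true).card : ℝ) + 2 * ε * 2 ^ n := by
    have hsub : (univ.filter fun u : Fin n → Bool => wt u % 3 = 0) ⊆
        (univ.filter fun u : Fin n → Bool => f u = true) ∪
        (univ.filter fun u : Fin n → Bool => ¬ (w₀ ≤ wt u ∧ wt u < w₀ + d)) := by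
      intro u hu
      rw [Finset.mem_filter] at hu
      rw [Finset.mem_union, Finset.mem_filter, Finset.mem_filter]
      by_cases hw : w₀ ≤ wt u ∧ wt u < w₀ + d
      · exact Or.inl ⟨Finset.mem_univ _, (hf_window u hw.1 hw.2).2 hu.2⟩
      · exact Or.inr ⟨Finset.mem_univ _, hw⟩
    calc ((univ.filter fun u : Fin n → Bool => wt u % 3 = 0).card : ℝ)
        ≤ (((univ.filter fun u : Fin n → Bool => f u = true) ∪
            (univ.filter fun u : Fin n → Bool => ¬ (w₀ ≤ wt u ∧ wt u < w₀ + d))).card : ℝ) := by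
          exact_mod_cast Finset.card_le_card hsub
      _ ≤ ((univ.filter fun u : Fin n → Bool => f u = true).card : ℝ) +
            ((univ.filter fun u : Fin n → Bool => ¬ (w₀ ≤ wt u ∧ wt u < w₀ + d)).card : ℝ) := by
          exact_mod_cast Finset.card_union_le _ _
      _ ≤ _ := add_le_add le_rfl houtside
  -- `ε ≤ e^{-8} κ₀^8`
  have hεbound : ε ≤ Real.exp (-8) * κ₀ ^ 8 := by
    rw [hε, ← exp_neg_eight_mul_le hκ₀, Real.exp_le_exp, neg_le_neg_iff]
    -- `8(1+L) ≤ 2γ²n = (d-1)²/(2n)` from `d - 1 ≥ D' n / 2 ≥ 4 √(n(1+L))`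
    have hD := hn₁ n hn₁n
    have hL0 : 0 ≤ 1 + Real.log (1 / κ₀) := by
      have : 0 ≤ Real.log (1 / κ₀) := Real.log_nonneg (by
        rw [le_div_iff₀ hκ₀]; linarith)
      linarith
    have hsq : Real.sqrt (n * (1 + Real.log (1 / κ₀))) ^ 2 = n * (1 + Real.log (1 / κ₀)) :=
      Real.sq_sqrt (by positivity)
    have hd1R : (4 : ℝ) * Real.sqrt (n * (1 + Real.log (1 / κ₀))) ≤ ((d - 1 : ℕ) : ℝ) := by
      have h1 : ((d - 1 : ℕ) : ℝ) = (d : ℝ) - 1 := by rw [Nat.cast_sub hdpos]; simp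
      have h2 : ((D' n : ℕ) : ℝ) + 2 ≤ 2 * d := by exact_mod_cast (by omega : D' n + 2 ≤ 2 * d)
      rw [h1]
      linarith
    have hγ2n : 2 * γ ^ 2 * n = ((d - 1 : ℕ) : ℝ) ^ 2 / (2 * n) := by
      rw [hγ]
      calc 2 * (((d - 1 : ℕ) : ℝ) / (2 * n)) ^ 2 * n = ((d - 1 : ℕ) : ℝ) ^ 2 / (2 * n) * (n / n) := by
            ring
        _ = ((d - 1 : ℕ) : ℝ) ^ 2 / (2 * n) := by rw [div_self (ne_of_gt hnpos), mul_one]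
    rw [hγ2n, le_div_iff₀ (by positivity)]
    have hs0 : 0 ≤ Real.sqrt (n * (1 + Real.log (1 / κ₀))) := Real.sqrt_nonneg _
    nlinarith [hd1R, hsq, hs0]
  -- numerics
  have hclass0R : (2 : ℝ) ^ n ≤ 3 * ((univ.filter fun u : Fin n → Bool => wt u % 3 = 0).card : ℝ) + 2 := by
    exact_mod_cast hclass0
  have he8 : Real.exp (-8) ≤ 1 := Real.exp_le_one_iff.2 (by norm_num)
  have hκ8 : κ₀ ^ 8 ≤ κ₀ * (1 / 3) ^ 7 := by
    have : κ₀ ^ 7 ≤ (1 / 3) ^ 7 := by gcongr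
    nlinarith
  have h2n : (4 : ℝ) ≤ 2 ^ n := by
    calc (4 : ℝ) = 2 ^ 2 := by norm_num
      _ ≤ 2 ^ n := pow_le_pow_right₀ (by norm_num) hn2
  have hP0 : (0 : ℝ) < (2 : ℝ) ^ n := by positivity
  have hεκ : ε * 2 ^ n ≤ κ₀ * 2 ^ n / 2187 := by
    have : ε ≤ κ₀ / 2187 := by
      calc ε ≤ Real.exp (-8) * κ₀ ^ 8 := hεbound
        _ ≤ 1 * (κ₀ * (1 / 3) ^ 7) := by gcongr
        _ = κ₀ / 2187 := by ring
    have := mul_le_mul_of_nonneg_right this hP0.le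
    linarith
  have hE0 : 0 ≤ ε * 2 ^ n := by positivity
  -- linear bookkeeping in the monomials `κ₀·#supp`, `κ₀·#cls0`, `κ₀·ε2ⁿ`, `κ₀·2ⁿ`
  have q1 := mul_le_mul_of_nonneg_left hgood hκ₀.le
  have q2 := mul_le_mul_of_nonneg_left hclass0R hκ₀.le
  have q3 := mul_le_mul_of_nonneg_left h2n hκ₀.le
  have q4 : κ₀ * (ε * 2 ^ n) ≤ ε * 2 ^ n := mul_le_of_le_one_left hE0 (by linarith)
  simp only [Nat.one_mod] at H hbad
  linarith [H, hbad, q1, q2, q3, q4, hεκ]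

/-- The typed fence `NotPLDAMSAboveSqrtLog` (Sketch11 §23.5b; first proved in `PLDAMSFence.lean`)
from the absolute-constant form. [folklore] -/
theorem notPLDAMSAboveSqrtLog_of_absolute : NotPLDAMSAboveSqrtLog := by
  obtain ⟨C, hC, h⟩ := not_pldams_above_sqrt_log_absolute
  exact fun κ₀ hκ₀ => ⟨C, hC, h κ₀ hκ₀⟩

end Summit.QuantumAdvantage.AdviceFreeQNC0

end
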